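import Literature.NumberTheory.LFunctions.MoebiusAutomaticCarry
import Literature.NumberTheory.LFunctions.MoebiusAutomaticFourierContraction
import HarnessLib

/-!
# The carry property of the RELABELLED transducer outputs (Müllner 2017, Lemma 4.10 for `T̄`; proved)

Everything in this file is PROVED. `MoebiusAutomaticCarry.lean` proves Müllner's Lemma 4.10 —
the carry property (Def. 4.1) of `n ↦ T(M, (n)_k)` read from a zero-stable state `M` of the
naturally induced transducer — for the PLAIN outputs `MinImage.T`. Müllner's §4 works with the
transducer after the relabelling of §2 (Prop. 2.6 / Lemma 2.14 / Lemma 2.22), i.e. with the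
outputs `T̄(M, w) = ρ_M⁻¹ ≫ T(M, w) ≫ ρ_{δ(M,w)}` (`MinImage.Tρ`,
`AutomaticSequenceTransducerRelabel.lean`, product form `MinImage.Tρ_eq_mul` in
`MoebiusAutomaticFourierContraction.lean`), and this file transfers the lemma:

* `MinImage.next_digits_eq_next_digits_mod_of_sync` — under the hypotheses of the mechanism
  `MinImage.carry_eq_of_sync` (a synchronizing word in the digit block `[α+v+1, α+ρ)`), the END
  STATES of `x` and `x mod k^{α+ρ}` read from `M` agree as well;
* `MinImage.carry_eq_of_syncρ`, `MinImage.carryViolationsρ_subset` — hence the relabelled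
  quotients `T̄(x) T̄(y)⁻¹ = ρ_{δ(M,x)} T(x) T(y)⁻¹ ρ_{δ(M,y)}⁻¹` obey the same mechanism and the
  violations of `n ↦ T̄(M,(n)_k)` are covered by the same bad sets `carryBadTop ∪ ⋃_v carryBad`;
* `exists_carry_count_bound` — the counting estimate of Lemma 4.10 in closed form,
  `k^{λ-ρ}(1 + k ∑_{j<ρ} #syncBad(j)) ≤ C k^{λ-ηρ}` with `0 < η ≤ 1`;
* **`MinImage.hasCarryProperty_Tρ`** — for every relabelling `ρ` and every zero-stable `M`,
  `n ↦ T̄(M, (n)_k)` has the carry property `HasCarryProperty k η C` (one `η ∈ (0,1]`, one `C`,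
  for all `ρ` and `M`).

## References
* C. Müllner, Duke Math. J. 166 (2017) = arXiv:1602.03042: Def. 4.1 (p. 19), Lemma 4.10 (p. 22),
  Prop. 2.6 (relabelling). [Mullner2017]
-/

noncomputable section

open Finset

namespace Literature.NumberTheory.LFunctions

/-! ## The counting estimate of Lemma 4.10, in closed form -/

/-- **The count of Lemma 4.10**: for a digit word `w₀` of length `s ≥ 1` there are `η ∈ (0, 1]`
and `C` with `k^{λ-ρ}(1 + k ∑_{j<ρ} #syncBad(j)) ≤ C k^{λ − ηρ}` for all `ρ ≤ λ`
(`#syncBad(j) ≤ k^j θ^{⌊j/s⌋}`, `θ = 1 − k^{-s}`; the computation of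
`MinImage.hasCarryProperty_T`). [cite: Mullner2017, Lemma 4.10] -/
theorem exists_carry_count_bound {k : ℕ} (hk : 2 ≤ k) {w₀ : List ℕ} (hw₀d : ∀ d ∈ w₀, d < k)
    (hw₀len : 0 < w₀.length) :
    ∃ η : ℝ, 0 < η ∧ η ≤ 1 ∧ ∃ C : ℝ, ∀ lam ρ : ℕ, ρ ≤ lam →
      ((k ^ (lam - ρ) * (1 + k * ∑ j ∈ range ρ, (syncBad k j w₀).card) : ℕ) : ℝ) ≤
        C * (k : ℝ) ^ ((lam : ℝ) - η * ρ) := by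
  have hk1 : 1 < k := hk
  have hkR : (1 : ℝ) < k := by exact_mod_cast hk1
  have hkR0 : (0 : ℝ) < k := by linarith
  set s := w₀.length with hs
  have hks1 : 1 < k ^ s := Nat.one_lt_pow hw₀len.ne' hk1
  set θ : ℝ := ((k ^ s - 1 : ℕ) : ℝ) / (k : ℝ) ^ s with hθ
  have hksR : (0 : ℝ) < (k : ℝ) ^ s := pow_pos hkR0 s
  have hθnum : ((k ^ s - 1 : ℕ) : ℝ) = (k : ℝ) ^ s - 1 := by
    rw [Nat.cast_sub hks1.le]; push_cast; ring
  have hθpos : 0 < θ := by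
    rw [hθ, hθnum]; apply div_pos _ hksR
    have : (1 : ℝ) < (k : ℝ) ^ s := by exact_mod_cast hks1
    linarith
  have hθlt : θ < 1 := by
    rw [hθ, hθnum, div_lt_one hksR]; linarith
  set ψ : ℝ := θ ^ ((s : ℝ)⁻¹) with hψ
  have hψs : ψ ^ s = θ := Real.rpow_inv_natCast_pow hθpos.le hw₀len.ne'
  have hψpos : 0 < ψ := Real.rpow_pos_of_pos hθpos _
  have hψlt : ψ < 1 := by
    by_contra h
    have : 1 ≤ ψ ^ s := one_le_pow₀ (not_lt.1 h)
    rw [hψs] at this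
    linarith
  set ψ₁ : ℝ := max ψ (2 / 3) with hψ₁
  have hψ₁pos : 0 < ψ₁ := hψpos.trans_le (le_max_left _ _)
  have hψ₁lt : ψ₁ < 1 := max_lt hψlt (by norm_num)
  have hψψ₁ : ψ ≤ ψ₁ := le_max_left _ _
  have hkψ₁ : 4 / 3 ≤ k * ψ₁ := by
    have h2 : (2 : ℝ) ≤ k := by exact_mod_cast hk
    have h3 : (2 : ℝ) / 3 ≤ ψ₁ := le_max_right _ _
    nlinarith
  -- the exponent `η ≤ 1` (since `ψ₁ ≥ 2/3 ≥ 1/k`) and the constant `C`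
  set η : ℝ := -Real.log ψ₁ / Real.log k with hη
  have hlogk : 0 < Real.log k := Real.log_pos hkR
  have hlogψ₁ : Real.log ψ₁ < 0 := Real.log_neg hψ₁pos hψ₁lt
  have hηpos : 0 < η := div_pos (by linarith) hlogk
  have hη1 : η ≤ 1 := by
    rw [hη, div_le_one hlogk, neg_le, ← Real.log_inv]
    apply Real.log_le_log (inv_pos.2 hkR0)
    have h2 : (2 : ℝ) ≤ k := by exact_mod_cast hk
    have h3 : (2 : ℝ) / 3 ≤ ψ₁ := le_max_right _ _
    calc (k : ℝ)⁻¹ ≤ 2⁻¹ := by gcongr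
      _ ≤ ψ₁ := by linarith
  set C : ℝ := 1 + 3 * k / θ with hC
  refine ⟨η, hηpos, hη1, C, fun lam ρ hρ => ?_⟩
  -- the sum of `#syncBad(j)`
  have hsync : ∀ j : ℕ, ((syncBad k j w₀).card : ℝ) ≤ θ⁻¹ * (k * ψ₁) ^ j := by
    intro j
    refine (MinImage.card_syncBad_le_real hk1 hw₀d j).trans ?_
    rw [← hs, ← hθ]
    have hjs : j ≤ s * (j / s) + s := by
      have := Nat.mod_lt j hw₀len; have := Nat.div_add_mod j s; omega
    have h1' : θ ^ (j / s) * θ ≤ ψ ^ j := by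
      rw [← hψs, ← pow_mul, ← pow_add]
      exact pow_le_pow_of_le_one hψpos.le hψlt.le hjs
    have h2 : θ ^ (j / s) ≤ θ⁻¹ * ψ ^ j := by
      rw [le_inv_mul_iff₀ hθpos, mul_comm]; exact h1'
    calc (k : ℝ) ^ j * θ ^ (j / s) ≤ (k : ℝ) ^ j * (θ⁻¹ * ψ ^ j) := by gcongr
      _ = θ⁻¹ * (k * ψ) ^ j := by rw [mul_pow]; ring
      _ ≤ θ⁻¹ * (k * ψ₁) ^ j := by gcongr
  have hsum : (∑ j ∈ range ρ, ((syncBad k j w₀).card : ℝ)) ≤ θ⁻¹ * (3 * (k * ψ₁) ^ ρ) := by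
    calc (∑ j ∈ range ρ, ((syncBad k j w₀).card : ℝ)) ≤ ∑ j ∈ range ρ, θ⁻¹ * (k * ψ₁) ^ j :=
          sum_le_sum fun j _ => hsync j
      _ = θ⁻¹ * ∑ j ∈ range ρ, (k * ψ₁) ^ j := by rw [mul_sum]
      _ ≤ θ⁻¹ * (3 * (k * ψ₁) ^ ρ) := by
          gcongr
          exact MinImage.geom_sum_le_three_mul_pow hkψ₁ ρ
  have hpow : (k : ℝ) ^ (lam - ρ) * (k : ℝ) ^ ρ = (k : ℝ) ^ lam := by
    rw [← pow_add, Nat.sub_add_cancel hρ]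
  have hmain : ((k ^ (lam - ρ) * (1 + k * ∑ j ∈ range ρ, (syncBad k j w₀).card) : ℕ) : ℝ) ≤
      C * (k : ℝ) ^ lam * ψ₁ ^ ρ := by
    push_cast
    calc (k : ℝ) ^ (lam - ρ) * (1 + k * ∑ j ∈ range ρ, ((syncBad k j w₀).card : ℝ))
        ≤ (k : ℝ) ^ (lam - ρ) * (1 + k * (θ⁻¹ * (3 * (k * ψ₁) ^ ρ))) := by gcongr
      _ ≤ (k : ℝ) ^ (lam - ρ) * ((1 + 3 * k / θ) * (k * ψ₁) ^ ρ) := by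
          gcongr
          have : k * (θ⁻¹ * (3 * (k * ψ₁) ^ ρ)) = 3 * k / θ * (k * ψ₁) ^ ρ := by
            field_simp
          rw [this, add_mul, one_mul]
          gcongr
          exact one_le_pow₀ (by linarith)
      _ = C * (k : ℝ) ^ lam * ψ₁ ^ ρ := by rw [hC, mul_pow, ← hpow]; ring
  have hrpow : (k : ℝ) ^ lam * ψ₁ ^ ρ = (k : ℝ) ^ ((lam : ℝ) - η * ρ) := by
    have hexp : (k : ℝ) ^ (-(η * ρ)) = ψ₁ ^ ρ := by
      rw [Real.rpow_def_of_pos hkR0, hη]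
      have : Real.log k * -(-Real.log ψ₁ / Real.log k * ρ) = ρ * Real.log ψ₁ := by
        field_simp
      rw [this, Real.exp_nat_mul, Real.exp_log hψ₁pos]
    rw [sub_eq_add_neg, Real.rpow_add hkR0, Real.rpow_natCast, hexp]
  calc ((k ^ (lam - ρ) * (1 + k * ∑ j ∈ range ρ, (syncBad k j w₀).card) : ℕ) : ℝ)
      ≤ C * (k : ℝ) ^ lam * ψ₁ ^ ρ := hmain
    _ = C * (k : ℝ) ^ ((lam : ℝ) - η * ρ) := by rw [mul_assoc, hrpow]

namespace MinImage

variable {σ : Type*} [Fintype σ] [DecidableEq σ] {δ : σ → ℕ → σ}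

/-! ## Relabelled outputs from a zero-stable state -/

/-- **End states agree under the mechanism of Lemma 4.10**: with `M` zero-stable, if the digits
of `x` in positions `[α+v+1, α+ρ)` (`v < ρ`) contain a synchronizing word `w₀`, then
`δ(M, (x)_k) = δ(M, (x mod k^{α+ρ})_k)`. [cite: Mullner2017, Lemma 4.10 (proof)] -/
theorem next_digits_eq_next_digits_mod_of_sync {k : ℕ} (hk : 2 ≤ k) {M : MinImage δ}
    (h0 : M.next [0] = M) {w₀ : List ℕ} (hw₀ : (fullImage δ w₀).card = minRank δ)
    {α ρ v x : ℕ} (hv : v < ρ)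
    (hmid : w₀ <:+: msbBlock k (ρ - v - 1) (x / k ^ (α + v + 1) % k ^ (ρ - v - 1))) :
    M.next ((Nat.digits k x).reverse) = M.next ((Nat.digits k (x % k ^ (α + ρ))).reverse) := by
  have hk1 : 1 < k := hk
  have hk0 : 0 < k := by omega
  set c := α + v + 1 with hc
  set e := ρ - v - 1 with he
  have hec : α + ρ = e + c := by omega
  set P := k ^ (α + ρ) with hP
  have hPpos : 0 < P := pow_pos hk0 _
  set Ltop := x / P with hLtop
  have hlt : Ltop < k ^ Ltop := Nat.lt_pow_self hk1
  -- read `x` as the padded block of length `Ltop + (α + ρ)`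
  have htop : M.next ((Nat.digits k x).reverse) =
      (M.next (msbBlock k Ltop Ltop)).next (msbBlock k (α + ρ) (x % P)) := by
    rw [← next_msbBlock_eq h0 k (Ltop + (α + ρ)) x]
    conv_lhs => rw [← Nat.div_add_mod x P]
    rw [hP, msbBlock_add hk1 hlt (Nat.mod_lt _ hPpos), next_append]
  have hlow : M.next ((Nat.digits k (x % P)).reverse) = M.next (msbBlock k (α + ρ) (x % P)) :=
    (next_msbBlock_eq h0 k (α + ρ) (x % P)).symm
  have hsplit : msbBlock k (α + ρ) (x % P) =
      msbBlock k e (x / k ^ c % k ^ e) ++ msbBlock k c (x % k ^ c) := by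
    rw [hP, hec]; exact msbBlock_mod_split hk1 x c e
  have hinf : w₀ <:+: msbBlock k (α + ρ) (x % P) := by
    rw [hsplit]
    exact hmid.trans (List.infix_append [] _ _)
  rw [htop, hlow]
  exact next_eq_next_of_infix _ _ hw₀ hinf

/-- **The mechanism of Lemma 4.10 for the relabelled outputs**: under the hypotheses of
`carry_eq_of_sync`, also `T̄(x) T̄(y)⁻¹ = T̄_{α+ρ}(x) T̄_{α+ρ}(y)⁻¹` for `T̄(n) = T̄(M, (n)_k)`.
[cite: Mullner2017, Lemma 4.10 (proof), Prop. 2.6] -/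
theorem carry_eq_of_syncρ {k : ℕ} (hk : 2 ≤ k) (ρ' : MinImage δ → Equiv.Perm (Fin (minRank δ)))
    {M : MinImage δ} (h0 : M.next [0] = M) (h1 : M.T [0] = 1) {w₀ : List ℕ}
    (hw₀ : (fullImage δ w₀).card = minRank δ) {α ρ v x y : ℕ} (hv : v < ρ)
    (hxy : x / k ^ (α + v + 1) = y / k ^ (α + v + 1))
    (hmid : w₀ <:+: msbBlock k (ρ - v - 1) (y / k ^ (α + v + 1) % k ^ (ρ - v - 1))) :
    M.Tρ ρ' ((Nat.digits k x).reverse) * (M.Tρ ρ' ((Nat.digits k y).reverse))⁻¹ =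
      M.Tρ ρ' ((Nat.digits k (x % k ^ (α + ρ))).reverse) *
        (M.Tρ ρ' ((Nat.digits k (y % k ^ (α + ρ))).reverse))⁻¹ := by
  have hT := carry_eq_of_sync hk h0 h1 hw₀ hv hxy hmid
  have hmidx : w₀ <:+: msbBlock k (ρ - v - 1) (x / k ^ (α + v + 1) % k ^ (ρ - v - 1)) := by
    rwa [hxy]
  have hNx := next_digits_eq_next_digits_mod_of_sync hk h0 hw₀ (α := α) hv hmidx
  have hNy := next_digits_eq_next_digits_mod_of_sync hk h0 hw₀ (α := α) hv hmid
  simp only [Tρ_eq_mul, mul_inv_rev, inv_inv]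
  rw [hNx, hNy]
  calc ρ' (M.next (Nat.digits k (x % k ^ (α + ρ))).reverse) * M.T (Nat.digits k x).reverse * (ρ' M)⁻¹ *
        (ρ' M * ((M.T (Nat.digits k y).reverse)⁻¹ * (ρ' (M.next (Nat.digits k (y % k ^ (α + ρ))).reverse))⁻¹))
      = ρ' (M.next (Nat.digits k (x % k ^ (α + ρ))).reverse) *
          (M.T (Nat.digits k x).reverse * (M.T (Nat.digits k y).reverse)⁻¹) *
            (ρ' (M.next (Nat.digits k (y % k ^ (α + ρ))).reverse))⁻¹ := by group
    _ = ρ' (M.next (Nat.digits k (x % k ^ (α + ρ))).reverse) *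
          (M.T (Nat.digits k (x % k ^ (α + ρ))).reverse * (M.T (Nat.digits k (y % k ^ (α + ρ))).reverse)⁻¹) *
            (ρ' (M.next (Nat.digits k (y % k ^ (α + ρ))).reverse))⁻¹ := by rw [hT]
    _ = _ := by group

/-- **The violations of `n ↦ T̄(M,(n)_k)` are covered by the bad sets** (as for `T`).
[cite: Mullner2017, Lemma 4.10 (proof)] -/
theorem carryViolationsρ_subset {k : ℕ} (hk : 2 ≤ k) (ρ' : MinImage δ → Equiv.Perm (Fin (minRank δ)))
    {M : MinImage δ} (h0 : M.next [0] = M) (h1 : M.T [0] = 1) {w₀ : List ℕ}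
    (hw₀ : (fullImage δ w₀).card = minRank δ) (lam α ρ : ℕ) :
    carryViolations k (fun n => M.Tρ ρ' ((Nat.digits k n).reverse)) lam α ρ ⊆
      carryBadTop k lam ρ ∪ (range ρ).biUnion fun v => carryBad k lam ρ v w₀ := by
  have hk1 : 1 < k := hk
  have hk0 : 0 < k := by omega
  have hkne : k ≠ 1 := by omega
  intro ℓ hℓ
  rw [mem_carryViolations] at hℓ
  obtain ⟨hℓlam, n₁, hn₁, n₂, hn₂, hne⟩ := hℓ
  set A := k ^ α with hA
  have hApos : 0 < A := pow_pos hk0 α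
  set t := padicValNat k (ℓ + 1) with ht
  rw [mem_union, mem_biUnion]
  by_cases hρt : ρ ≤ t
  · left
    rw [mem_carryBadTop]
    exact ⟨hℓlam, (Nat.pow_dvd_iff_le_padicValNat hkne (by omega : ℓ + 1 ≠ 0)).2 hρt⟩
  · right
    have htρ : t < ρ := not_le.1 hρt
    refine ⟨t, mem_range.2 htρ, mem_carryBad.2 ⟨hℓlam, pow_padicValNat_dvd, fun hmid => hne ?_⟩⟩
    have hy : (ℓ * A + n₁) / A = ℓ := by
      rw [mul_comm, Nat.mul_add_div hApos, Nat.div_eq_of_lt hn₁, add_zero]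
    have hx : (ℓ * A + n₁ + n₂) / A = ℓ ∨ (ℓ * A + n₁ + n₂) / A = ℓ + 1 := by
      rw [add_assoc, mul_comm, Nat.mul_add_div hApos]
      have : (n₁ + n₂) / A ≤ 1 := by
        rw [Nat.div_le_iff_le_mul_add_pred hApos]; omega
      rcases Nat.le_one_iff_eq_zero_or_eq_one.1 this with h | h
      · left; rw [h, add_zero]
      · right; rw [h]
    have hnot : ¬ k ^ (t + 1) ∣ ℓ + 1 := by
      rw [Nat.pow_dvd_iff_le_padicValNat hkne (by omega : ℓ + 1 ≠ 0), ← ht]; omega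
    have hxy : (ℓ * A + n₁ + n₂) / k ^ (α + t + 1) = (ℓ * A + n₁) / k ^ (α + t + 1) := by
      rw [show α + t + 1 = α + (t + 1) by ring, pow_add, ← hA, ← Nat.div_div_eq_div_mul,
        ← Nat.div_div_eq_div_mul, hy]
      rcases hx with h | h
      · rw [h]
      · rw [h, Nat.succ_div_of_not_dvd hnot]
    have hyq : (ℓ * A + n₁) / k ^ (α + t + 1) = ℓ / k ^ (t + 1) := by
      rw [show α + t + 1 = α + (t + 1) by ring, pow_add, ← hA, ← Nat.div_div_eq_div_mul, hy]
    have h := carry_eq_of_syncρ hk ρ' h0 h1 hw₀ (α := α) htρ hxy (by rw [hyq]; exact hmid)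
    simpa only [hA] using h

/-- The count for `T̄`: `#carryViolations(λ, α, ρ) ≤ k^{λ-ρ} (1 + k ∑_{j<ρ} #syncBad(j))`.
[cite: Mullner2017, Lemma 4.10] -/
theorem card_carryViolationsρ_le {k : ℕ} (hk : 2 ≤ k) (ρ' : MinImage δ → Equiv.Perm (Fin (minRank δ)))
    {M : MinImage δ} (h0 : M.next [0] = M) (h1 : M.T [0] = 1) {w₀ : List ℕ}
    (hw₀ : (fullImage δ w₀).card = minRank δ) {lam α ρ : ℕ} (hρ : ρ ≤ lam) :
    (carryViolations k (fun n => M.Tρ ρ' ((Nat.digits k n).reverse)) lam α ρ).card ≤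
      k ^ (lam - ρ) * (1 + k * ∑ j ∈ range ρ, (syncBad k j w₀).card) := by
  calc (carryViolations k (fun n => M.Tρ ρ' ((Nat.digits k n).reverse)) lam α ρ).card
      ≤ (carryBadTop k lam ρ ∪ (range ρ).biUnion fun v => carryBad k lam ρ v w₀).card :=
        card_le_card (carryViolationsρ_subset hk ρ' h0 h1 hw₀ lam α ρ)
    _ ≤ (carryBadTop k lam ρ).card + ((range ρ).biUnion fun v => carryBad k lam ρ v w₀).card :=
        card_union_le _ _
    _ ≤ k ^ (lam - ρ) + ∑ v ∈ range ρ, (carryBad k lam ρ v w₀).card :=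
        add_le_add (card_carryBadTop_le hk hρ) card_biUnion_le
    _ ≤ k ^ (lam - ρ) + ∑ v ∈ range ρ, k ^ (lam - ρ) * ((syncBad k (ρ - v - 1) w₀).card * k) := by
        gcongr with v hv
        exact card_carryBad_le hk (mem_range.1 hv) hρ
    _ = k ^ (lam - ρ) * (1 + k * ∑ j ∈ range ρ, (syncBad k j w₀).card) := by
        rw [← mul_sum, ← sum_range_reflect (fun j => (syncBad k j w₀).card) ρ, mul_sum, mul_sum,
          mul_add, mul_one, mul_sum]
        congr 1
        refine sum_congr rfl fun v hv => ?_
        rw [show ρ - 1 - v = ρ - v - 1 by omega]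
        ring

/-- **Müllner 2017, Lemma 4.10 for the relabelled transducer.** For a base-`k` automaton
(`k ≥ 2`, letters `≥ k` acting trivially) there are `η ∈ (0, 1]` and `C` such that for EVERY
relabelling `ρ` and every zero-stable state `M` the sequence `n ↦ T̄(M, (n)_k)` of relabelled
outputs (`MinImage.Tρ`) has the carry property `HasCarryProperty k η C` (Def. 4.1).
[cite: Mullner2017, Lemma 4.10] -/
theorem hasCarryProperty_Tρ {k : ℕ} (hk : 2 ≤ k) (htriv : ∀ q d, k ≤ d → δ q d = q) :
    ∃ η : ℝ, 0 < η ∧ η ≤ 1 ∧ ∃ C : ℝ, ∀ (ρ' : MinImage δ → Equiv.Perm (Fin (minRank δ)))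
      (M : MinImage δ), M.next [0] = M → M.T [0] = 1 →
        HasCarryProperty k η C (fun n => M.Tρ ρ' ((Nat.digits k n).reverse)) := by
  have hk0 : 0 < k := by omega
  obtain ⟨w₀, hw₀d, hw₀len, hw₀⟩ := exists_sync_digit_word (δ := δ) htriv hk0
  obtain ⟨η, hη0, hη1, C, hC⟩ := exists_carry_count_bound hk hw₀d hw₀len
  refine ⟨η, hη0, hη1, C, fun ρ' M h0 h1 lam α ρ hρ => ?_⟩
  have hcount := card_carryViolationsρ_le hk ρ' h0 h1 hw₀ (lam := lam) (α := α) hρ.le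
  exact (by exact_mod_cast hcount : ((carryViolations k (fun n => M.Tρ ρ' ((Nat.digits k n).reverse))
      lam α ρ).card : ℝ) ≤ ((k ^ (lam - ρ) * (1 + k * ∑ j ∈ range ρ, (syncBad k j w₀).card) : ℕ) : ℝ)).trans
    (hC lam ρ hρ.le)

end MinImage

end Literature.NumberTheory.LFunctions
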